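import Summits.ValiantsHypothesis.ValiantsHypothesis.Theorems.KPlusLogSqLawTropicalBBoundarySectorRelabel

/-!
# Route «KPlusLogSqLaw», crux `TropicalB` (stmt-ValiantsHypothesis-19771) — boundary-type sector: the ADDITIVE-EXPONENT case
# `#exposed ≤ (m+1)^B` (so the content of `BoundaryVertexLaw 2 2` is the generic, non-additive exponent table)

HONEST FRAMING.  Helper toward the registered stubs of `Cruxes/TropicalB/Lines/birth.lean` (crux
`Summit.ValiantsHypothesis.ValiantsHypothesis.Theses.KPlusLogSqLaw.TropicalB`, item `stmt-ValiantsHypothesis-19771`, route `KPlusLogSqLaw`,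
DRAFT; cell `pub-symmetroid`, seat val-sym-trop-p1 g2).  Companion of `…TropicalBBoundarySectorDefs` / `…Counting` / `…Relabel`.
val-sym-trop-p2 g2's remark (REGISTERS-g2 «Recommended next» 2): if the exponents of a boundary-type design are ADDITIVE over the
boundaries — `d (lab P) = w₀ + Σ_j w_j·[P j]` — then the slope of a present term is `m·w₀ + Σ_j w_j · #{b : bit j}`, a function of the
`B` MARGINAL counts only, so an exposed chain has at most `(m+1)^B` terms.  Hence for `B = 2` the additive case already satisfies
`≤ (m+1)²` (this file), and the sector theorem `BoundaryVertexLaw 2 2` handed to the trop-p2 successor has content exactly for GENERIC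
(non-additive) four-exponent tables, where the mixed count `n₁₁` is slope-visible.

* `BoundarySector.slope_eq_of_additive` — the marginal formula for the slope;
* `BoundarySector.designRowD_boundary_additive` — unsigned row bound `(m+1)^B − 1` under additivity;
* `BoundarySector.card_dominant_le_of_additive` — at most `(m+1)^B` integer-exposed dominant terms under additivity.
Nothing here is in-window; nothing bears on `TropicalB`, `KPlusLogSqLaw`, `Lifting`, DoorA26 / DoorA34, `MatrixDescartes`
(`stmt-ValiantsHypothesis-18050`) or VP ≠ VNP.  [folklore: slope counting on marginals]
-/

-- `Summit.ValiantsHypothesis.ValiantsHypothesis.…` repeats a component by the D-0017 layout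
-- (single-conjunct summit), which the `dupNamespace` linter flags; the name is mandated.
set_option linter.dupNamespace false
set_option autoImplicit false

namespace Summit.ValiantsHypothesis.ValiantsHypothesis.Theorems.KPlusLogSqLaw

open Summit.ValiantsHypothesis.ValiantsHypothesis.Theorems.MatrixDescartes.Negative
open Summit.ValiantsHypothesis.ValiantsHypothesis.Theorems.LacunarySymmetroidMatrixDescartes
open Finset

namespace BoundarySector

variable {m K B : ℕ}

/-- **Marginal formula.**  If the exponent table is additive over the boundaries, `d (lab P) = w₀ + Σ_j w_j·[P j]`, then the slope of a
present term is `m·w₀ + Σ_j w_j · #{b : pattern (σ b) b j}`. [folklore] -/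
theorem slope_eq_of_additive {π ρ : Fin B → Equiv.Perm (Fin m)} {lab : (Fin B → Bool) → Fin K} (d : Fin K → ℕ)
    (w₀ : ℤ) (w : Fin B → ℤ) (hadd : ∀ P : Fin B → Bool, (d (lab P) : ℤ) = w₀ + ∑ j, if P j then w j else 0)
    {ε : Fin m → Fin m → Fin K → ℤ} (hε : IsBoundaryDesign π ρ lab ε) {q : Equiv.Perm (Fin m) × (Fin m → Fin K)}
    (hq : termSign ε q ≠ 0) :
    TropicalCensus.slope d q =
      m * w₀ + ∑ j, w j * ((univ.filter fun b : Fin m => pattern π ρ (q.1 b) b j = true).card : ℤ) := by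
  classical
  rw [slope_eq_of_present d hε hq, sum_congr rfl (fun b _ => hadd (pattern π ρ (q.1 b) b)), sum_add_distrib, sum_const,
    card_univ, Fintype.card_fin, nsmul_eq_mul, sum_comm]
  congr 1
  refine sum_congr rfl fun j _ => ?_
  rw [← sum_filter, sum_const, nsmul_eq_mul, mul_comm]

/-- **Additive exponents: unsigned row bound `(m+1)^B − 1`.**  The marginal count vector `j ↦ #{b : bit j}` is injective along a
chain (slopes strictly increase and depend only on it). [folklore] -/
theorem designRowD_boundary_additive (π ρ : Fin B → Equiv.Perm (Fin m)) (lab : (Fin B → Bool) → Fin K) (d : Fin K → ℕ)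
    (w₀ : ℤ) (w : Fin B → ℤ) (hadd : ∀ P : Fin B → Bool, (d (lab P) : ℤ) = w₀ + ∑ j, if P j then w j else 0)
    (v ε : Fin m → Fin m → Fin K → ℤ) (hε : IsBoundaryDesign π ρ lab ε) :
    DesignRowD d v ε ((m + 1) ^ B - 1) := by
  classical
  intro n θ p hθ hdom hne
  have hsm := slope_strictMono_of_chainD d v ε θ p hθ hdom hne
  have hcle : ∀ (k : Fin (n + 1)) (j : Fin B),
      (univ.filter fun b : Fin m => pattern π ρ ((p k).1 b) b j = true).card < m + 1 := fun k j =>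
    Nat.lt_succ_of_le ((card_filter_le _ _).trans (by rw [card_univ, Fintype.card_fin]))
  let marg : Fin (n + 1) → (Fin B → Fin (m + 1)) := fun k j =>
    ⟨(univ.filter fun b : Fin m => pattern π ρ ((p k).1 b) b j = true).card, hcle k j⟩
  have hinj : Function.Injective marg := by
    intro k k' h
    apply hsm.injective
    simp only
    rw [slope_eq_of_additive d w₀ w hadd hε (hdom k).1, slope_eq_of_additive d w₀ w hadd hε (hdom k').1]
    congr 1
    refine sum_congr rfl fun j _ => ?_
    have hj := congrArg (fun f => ((f j : Fin (m + 1)) : ℕ)) h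
    simp only [marg] at hj
    rw [hj]
  have hcard := Fintype.card_le_of_injective marg hinj
  rw [Fintype.card_fin, Fintype.card_fun, Fintype.card_fin, Fintype.card_fin] at hcard
  have hpos : 1 ≤ (m + 1) ^ B := Nat.one_le_pow _ _ (Nat.succ_pos m)
  omega

/-- **Additive exponents: at most `(m+1)^B` integer-exposed dominant terms** on a boundary-type design with `B` boundaries (vertex-count
currency).  For `B = 2` this is the quadratic bound that `BoundaryVertexLaw 2 2` asks for in general. [folklore] -/
theorem card_dominant_le_of_additive (π ρ : Fin B → Equiv.Perm (Fin m)) (lab : (Fin B → Bool) → Fin K) (d : Fin K → ℕ)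
    (w₀ : ℤ) (w : Fin B → ℤ) (hadd : ∀ P : Fin B → Bool, (d (lab P) : ℤ) = w₀ + ∑ j, if P j then w j else 0)
    (v ε : Fin m → Fin m → Fin K → ℤ) (hε : IsBoundaryDesign π ρ lab ε) :
    haveI := Classical.decPred fun q : Equiv.Perm (Fin m) × (Fin m → Fin K) => ∃ t : ℤ, IsDominant d v ε t q
    (univ.filter fun q : Equiv.Perm (Fin m) × (Fin m → Fin K) => ∃ t : ℤ, IsDominant d v ε t q).card ≤ (m + 1) ^ B := by
  classical
  have h := card_dominant_le_succ d v ε (designRowD_boundary_additive π ρ lab d w₀ w hadd v ε hε)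
  have hpos : 1 ≤ (m + 1) ^ B := Nat.one_le_pow _ _ (Nat.succ_pos m)
  convert h using 1
  omega

end BoundarySector

end Summit.ValiantsHypothesis.ValiantsHypothesis.Theorems.KPlusLogSqLaw
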